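import Literature.Geometry.Lorentzian.BogovskiiOperator
import Literature.Geometry.Lorentzian.MomentPartition
import Mathlib.Topology.PartitionOfUnity
import Mathlib.Analysis.Calculus.BumpFunction.FiniteDimension
import Mathlib.Analysis.Calculus.BumpFunction.Normed
import HarnessLib

/-!
# Gluing Bogovskiĭ-type operators (the recursion of Mao–Oh–Tao's Lemma 2.2), weak form

(trunk G08 = T-LORENTZ; family `gr`; namespace `Literature.Geometry.Lorentzian.MaoOhTao`.)

Mao–Oh–Tao (arXiv:2308.13031), proof of Lemma 2.2 (p. 9): a Bogovskiĭ-type operator (one satisfying (S1)–(S4)) exists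
on every open set star-shaped with respect to a ball (Lemma 2.3), and "a Bogovskii-type operator can be defined on the
union of any two open sets on each of which such an operator is defined" — by splitting the density,
`f = f₁ + f₂` with `f_k = momentPart η f χ_k` supported in `U_k` and with vanishing moments (`MomentPartition.lean`),
and setting `S f := S₁ f₁ + S₂ f₂`; "by a simple recursion argument" this gives an operator on the annulus `A₁`, a
finite union of such sets.  This file proves the (S1)–(S2) part of the recursion in weak form:

* `bogovskiiOperator_weak_inverse` — the base case: the operator of Lemma 2.3 (`BogovskiiOperator.lean`) inverts
  the double divergence weakly on continuous compactly supported densities with vanishing moments;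
* `sum_sum_integral_glue_mul_pd_pd_eq` — the gluing step for (S2): if `S_k` inverts the double divergence weakly on
  densities supported in `U_k`, then `S₁ f₁ + S₂ f₂` does so for densities `f` with `χ₁ + χ₂ = 1` on `supp f`,
  `tsupp (f χ_k) ⊆ U_k`, `η ∈ C_c(U₁ ∩ U₂)` non-zero;
* `support_glue_subset` — the gluing step for (S1);
* `exists_weak_inverse_union` — per density: weak inverses on `U₁`, `U₂` (open, `U₁ ∩ U₂ ≠ ∅`) give weak inverses on
  `U₁ ∪ U₂` (bump at a common point, partition of unity on `tsupp f`);
* `HasWeakDoubleDivInverse U` — the predicate "every admissible density on `U` has a weak inverse supported in `U`",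
  with `.of_starConvex` (base case, Lemma 2.3 with a normalised bump), `.union` and `.biUnion_le` (the recursion over
  a finite chain of open sets).

Everything is proved; one definition (the predicate `HasWeakDoubleDivInverse`), no named facts.  The density-wise
formulation chooses the cut-offs on `tsupp f`; the paper's operator is linear in `f` (fixed cut-offs) —
`TODO(general form)`: linearity and the bounds (S3), (S4).  Not treated: the bounds (S3), (S4) (which make the glued
operator bounded `H^{s'-2} → H^{s'}`), the linear choice of the cut-offs on `A₁`, and the covering of `A₁` by finitely
many sets star-shaped with respect to balls.

## References

* Y. Mao, S.-J. Oh, T. Tao, arXiv:2308.13031 (2023), Lemma 2.2 and its proof, p. 9 (key `MaoOhTao2023`).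
-/

noncomputable section

open scoped RealInnerProductSpace Topology ContDiff
open Filter MeasureTheory Set Metric Function

namespace Literature.Geometry.Lorentzian

namespace MaoOhTao

variable {χ : E3 → ℝ}

/-! ### Gluing two weak Bogovskiĭ-type operators (the recursion step of Lemma 2.2) -/

section Gluing

variable {η : E3 → ℝ} {χ₁ χ₂ : E3 → ℝ} {U₁ U₂ : Set E3}

/-- `f_k` vanishes where `f χ_k` and `η` do. [folklore] -/
theorem support_momentPart_subset' (η f χ : E3 → ℝ) :
    support (momentPart η f χ) ⊆ support (fun x ↦ f x * χ x) ∪ support η := by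
  intro x hx
  by_contra h
  rw [mem_union, not_or, notMem_support, notMem_support] at h
  apply hx
  simp [momentPart, h.1, theta_eq_zero_of_eta η _ h.2]

/-- `f_k` is supported in `U_k` (topologically) when `tsupp (f χ_k), tsupp η ⊆ U_k`. [folklore] -/
theorem tsupport_momentPart_subset {U : Set E3} {f : E3 → ℝ} (hχU : tsupport (fun x ↦ f x * χ x) ⊆ U)
    (hηU : tsupport η ⊆ U) : tsupport (momentPart η f χ) ⊆ U := by
  refine (closure_mono (support_momentPart_subset' η f χ)).trans ?_
  rw [closure_union]
  exact union_subset hχU hηU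

/-- In particular `tsupp f_k ⊆ U_k` when `tsupp χ_k ⊆ U_k` and `tsupp η ⊆ U_k`. [folklore] -/
theorem tsupport_momentPart_subset_of_tsupport {U : Set E3} (hχU : tsupport χ ⊆ U) (hηU : tsupport η ⊆ U)
    (f : E3 → ℝ) : tsupport (momentPart η f χ) ⊆ U :=
  tsupport_momentPart_subset ((tsupport_mul_subset_right (f := f) (g := χ)).trans hχU) hηU

/-- **The gluing step of Lemma 2.2, (S2) in weak form.** Let `S₁, S₂` be operators (densities ↦ symmetric-tensor
components) such that `S_k` inverts the double divergence weakly on `U_k`: for every continuous compactly supported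
`f` with `tsupp f ⊆ U_k` and `∫ f (1, x₁, x₂, x₃) = 0` and every `ψ ∈ C²_c`, the pairings `∫ (S_k f)^{ij} ∂ⱼ∂ᵢψ` converge
and sum to `∫ f ψ`.  Let `η ∈ C_c(U₁ ∩ U₂)`, `η ≠ 0`, and `χ₁, χ₂` continuous with `tsupp (f χ_k) ⊆ U_k` and `χ₁ + χ₂ = 1` on
`supp f`.  Then the glued operator `S f := S₁ f₁ + S₂ f₂` (`f_k = momentPart η f χ_k`) inverts the double divergence
weakly for every continuous compactly supported `f` with vanishing moments:
`Σ_{i,j} ∫ ((S₁ f₁)^{ij} + (S₂ f₂)^{ij}) ∂ⱼ∂ᵢψ = ∫ f ψ`. [cite: MaoOhTao2023, Lemma 2.2 (proof)] -/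
theorem sum_sum_integral_glue_mul_pd_pd_eq (S₁ S₂ : (E3 → ℝ) → Fin 3 → Fin 3 → E3 → ℝ)
    (h₁ : ∀ f : E3 → ℝ, Continuous f → HasCompactSupport f → tsupport f ⊆ U₁ →
      (∀ μ, ∫ y : E3, f y * momentFn μ y = 0) → ∀ ψ : E3 → ℝ, ContDiff ℝ 2 ψ → HasCompactSupport ψ →
        (∀ i j, Integrable fun x : E3 ↦ S₁ f i j x * pd j (pd i ψ) x) ∧
          ∑ i, ∑ j, ∫ x : E3, S₁ f i j x * pd j (pd i ψ) x = ∫ x : E3, f x * ψ x)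
    (h₂ : ∀ f : E3 → ℝ, Continuous f → HasCompactSupport f → tsupport f ⊆ U₂ →
      (∀ μ, ∫ y : E3, f y * momentFn μ y = 0) → ∀ ψ : E3 → ℝ, ContDiff ℝ 2 ψ → HasCompactSupport ψ →
        (∀ i j, Integrable fun x : E3 ↦ S₂ f i j x * pd j (pd i ψ) x) ∧
          ∑ i, ∑ j, ∫ x : E3, S₂ f i j x * pd j (pd i ψ) x = ∫ x : E3, f x * ψ x)
    (hη : Continuous η) (hηc : HasCompactSupport η) {x₀ : E3} (hx₀ : η x₀ ≠ 0) (hη₁ : tsupport η ⊆ U₁)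
    (hη₂ : tsupport η ⊆ U₂) (hχ₁ : Continuous χ₁) (hχ₂ : Continuous χ₂) {f : E3 → ℝ}
    (hχ₁U : tsupport (fun x ↦ f x * χ₁ x) ⊆ U₁) (hχ₂U : tsupport (fun x ↦ f x * χ₂ x) ⊆ U₂)
    (hf : Continuous f) (hfc : HasCompactSupport f)
    (hsum : ∀ x, f x ≠ 0 → χ₁ x + χ₂ x = 1) (hmom : ∀ μ, ∫ y : E3, f y * momentFn μ y = 0) {ψ : E3 → ℝ}
    (hψ : ContDiff ℝ 2 ψ) (hψc : HasCompactSupport ψ) :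
    ∑ i, ∑ j, ∫ x : E3, (S₁ (momentPart η f χ₁) i j x + S₂ (momentPart η f χ₂) i j x) * pd j (pd i ψ) x =
      ∫ x : E3, f x * ψ x := by
  have hf₁ := h₁ (momentPart η f χ₁) (continuous_momentPart hη hf hχ₁) (hasCompactSupport_momentPart hηc hfc χ₁)
    (tsupport_momentPart_subset hχ₁U hη₁)
    (fun μ ↦ integral_momentPart_mul_momentFn hη hηc hx₀ hf hfc hχ₁ μ) ψ hψ hψc
  have hf₂ := h₂ (momentPart η f χ₂) (continuous_momentPart hη hf hχ₂) (hasCompactSupport_momentPart hηc hfc χ₂)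
    (tsupport_momentPart_subset hχ₂U hη₂)
    (fun μ ↦ integral_momentPart_mul_momentFn hη hηc hx₀ hf hfc hχ₂ μ) ψ hψ hψc
  have hsplit : ∀ i j, ∫ x : E3, (S₁ (momentPart η f χ₁) i j x + S₂ (momentPart η f χ₂) i j x) * pd j (pd i ψ) x =
      (∫ x : E3, S₁ (momentPart η f χ₁) i j x * pd j (pd i ψ) x) +
        ∫ x : E3, S₂ (momentPart η f χ₂) i j x * pd j (pd i ψ) x := by
    intro i j
    rw [← integral_add (hf₁.1 i j) (hf₂.1 i j)]
    refine integral_congr_ae (ae_of_all _ fun x ↦ ?_)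
    simp only
    ring
  simp only [hsplit, Finset.sum_add_distrib]
  rw [hf₁.2, hf₂.2]
  have I : ∀ χ : E3 → ℝ, Continuous χ → Integrable fun x : E3 ↦ momentPart η f χ x * ψ x := fun χ hχ ↦
    ((continuous_momentPart hη hf hχ).mul hψ.continuous).integrable_of_hasCompactSupport
      (hasCompactSupport_momentPart hηc hfc χ).mul_right
  rw [← integral_add (I χ₁ hχ₁) (I χ₂ hχ₂)]
  refine integral_congr_ae (ae_of_all _ fun x ↦ ?_)
  simp only
  rw [← add_mul, momentPart_add_momentPart_of_moments hf hfc hχ₁ hχ₂ hsum hmom x]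

/-- **The gluing step of Lemma 2.2, (S1).** If `supp (S_k f_k)^{ij} ⊆ U_k` then the glued operator is supported in
`U₁ ∪ U₂`. [cite: MaoOhTao2023, Lemma 2.2 (proof)] -/
theorem support_glue_subset (S₁ S₂ : (E3 → ℝ) → Fin 3 → Fin 3 → E3 → ℝ) {f₁ f₂ : E3 → ℝ} {i j : Fin 3}
    (h₁ : support (S₁ f₁ i j) ⊆ U₁) (h₂ : support (S₂ f₂ i j) ⊆ U₂) :
    support (fun x ↦ S₁ f₁ i j x + S₂ f₂ i j x) ⊆ U₁ ∪ U₂ :=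
  (support_add (S₁ f₁ i j) (S₂ f₂ i j)).trans (union_subset_union h₁ h₂)

end Gluing


/-! ### The base case: the Bogovskiĭ-type operator of a star-shaped set -/

section Base

variable {ζ : E3 → ℝ} {R : ℝ}

/-- The moment conditions in `momentFn` form are `∫ f = 0` and `∫ yᵢ f = 0`. [folklore] -/
theorem moments_iff {f : E3 → ℝ} :
    (∀ μ, ∫ y : E3, f y * momentFn μ y = 0) ↔ (∫ y : E3, f y = 0) ∧ ∀ i : Fin 3, ∫ y : E3, y i * f y = 0 := by
  constructor
  · intro h
    refine ⟨by simpa using h none, fun i ↦ ?_⟩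
    have := h (some i)
    simp only [momentFn_some] at this
    rw [← this]
    exact integral_congr_ae (ae_of_all _ fun y ↦ mul_comm _ _)
  · rintro ⟨h0, h1⟩ μ
    cases μ with
    | none => simpa using h0
    | some i =>
      simp only [momentFn_some]
      rw [← h1 i]
      exact integral_congr_ae (ae_of_all _ fun y ↦ mul_comm _ _)

/-- **The Bogovskiĭ-type operator of Lemma 2.3 inverts the double divergence weakly** (base case of the recursion
in Lemma 2.2): for `ζ ∈ C¹_c` with `∫ ζ = 1`, every continuous compactly supported `f` with vanishing moments and every
`ψ ∈ C²_c`, the pairings `∫ (S f)^{ij} ∂ⱼ∂ᵢψ` converge and `Σ_{i,j} ∫ (S f)^{ij} ∂ⱼ∂ᵢψ dx = ∫ f ψ`,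
`(S f)^{ij}(x) = ∫ Ψ^{ij}_ζ(x, y) f(y) dy`. [cite: MaoOhTao2023, Lemma 2.3 (S2)] -/
theorem bogovskiiOperator_weak_inverse (hζ : ContDiff ℝ 1 ζ) (hR : ∀ z : E3, R < ‖z‖ → ζ z = 0)
    (hζ1 : ∫ z : E3, ζ z = 1) (f : E3 → ℝ) (hf : Continuous f) (hfc : HasCompactSupport f)
    (hmom : ∀ μ, ∫ y : E3, f y * momentFn μ y = 0) (ψ : E3 → ℝ) (hψ : ContDiff ℝ 2 ψ)
    (hψc : HasCompactSupport ψ) :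
    (∀ i j, Integrable fun x : E3 ↦ (∫ y : E3, bogovskiiWeight ζ y ‖x - y‖ (‖x - y‖⁻¹ • (x - y)) *
        ((x - y) i * ((x - y) j * (‖x - y‖ ^ 3)⁻¹)) * f y) * pd j (pd i ψ) x) ∧
      ∑ i, ∑ j, ∫ x : E3, (∫ y : E3, bogovskiiWeight ζ y ‖x - y‖ (‖x - y‖⁻¹ • (x - y)) *
        ((x - y) i * ((x - y) j * (‖x - y‖ ^ 3)⁻¹)) * f y) * pd j (pd i ψ) x = ∫ x : E3, f x * ψ x := by
  obtain ⟨hf0, hf1⟩ := moments_iff.1 hmom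
  have hg : ∀ i j, Continuous (pd j (pd i ψ)) := fun i j ↦
    ((contDiff_pd (n := 1) hψ i).continuous_fderiv one_ne_zero).clm_apply continuous_const
  have hgc : ∀ i j, HasCompactSupport (pd j (pd i ψ)) := fun i j ↦
    hasCompactSupport_pd (hasCompactSupport_pd hψc i) j
  refine ⟨fun i j ↦ ?_, ?_⟩
  · refine ((integrable_bogovskiiKernel_prod hζ.continuous hR hf hfc (hg i j) (hgc i j) i j).integral_prod_left).congr
      (ae_of_all _ fun x ↦ ?_)
    simp only
    rw [integral_mul_const]
  · rw [sum_sum_integral_bogovskiiOperator_mul_pd_pd_eq hζ hR hψ hψc hf hfc hf0 hf1, hζ1, one_mul]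

end Base

/-! ### Existence of weak inverses on a union (density-dependent gluing) -/

section Union

/-- **Weak inverses of the double divergence on a union.** Suppose that on each of two open sets `U₁, U₂` every
continuous compactly supported density with `tsupp f ⊆ U_k` and vanishing moments `∫ f (1, x₁, x₂, x₃) = 0` admits a
weak inverse of the double divergence supported in `U_k` — a field `T^{ij}` with `supp T^{ij} ⊆ U_k` and
`Σ_{i,j} ∫ T^{ij} ∂ⱼ∂ᵢψ = ∫ f ψ` for all `ψ ∈ C²_c` — and that `U₁ ∩ U₂ ≠ ∅`.  Then the same holds on `U₁ ∪ U₂`: split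
`f = f₁ + f₂` with a bump `η` at a point of `U₁ ∩ U₂` and a partition of unity on `tsupp f` subordinate to `{U₁, U₂}`
(`MomentPartition.lean`), and add the inverses of `f₁`, `f₂`.  (The paper fixes the cut-offs once and for all, making
`S f := S₁ f₁ + S₂ f₂` linear in `f`; here the partition of unity is chosen on `tsupp f`.)
[cite: MaoOhTao2023, Lemma 2.2 (proof)] -/
theorem exists_weak_inverse_union {U₁ U₂ : Set E3} (hU₁ : IsOpen U₁) (hU₂ : IsOpen U₂) {p : E3}
    (hp₁ : p ∈ U₁) (hp₂ : p ∈ U₂)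
    (h₁ : ∀ f : E3 → ℝ, Continuous f → HasCompactSupport f → tsupport f ⊆ U₁ →
      (∀ μ, ∫ y : E3, f y * momentFn μ y = 0) →
        ∃ T : Fin 3 → Fin 3 → E3 → ℝ, (∀ i j, support (T i j) ⊆ U₁) ∧
          ∀ ψ : E3 → ℝ, ContDiff ℝ 2 ψ → HasCompactSupport ψ →
            (∀ i j, Integrable fun x : E3 ↦ T i j x * pd j (pd i ψ) x) ∧
              ∑ i, ∑ j, ∫ x : E3, T i j x * pd j (pd i ψ) x = ∫ x : E3, f x * ψ x)
    (h₂ : ∀ f : E3 → ℝ, Continuous f → HasCompactSupport f → tsupport f ⊆ U₂ →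
      (∀ μ, ∫ y : E3, f y * momentFn μ y = 0) →
        ∃ T : Fin 3 → Fin 3 → E3 → ℝ, (∀ i j, support (T i j) ⊆ U₂) ∧
          ∀ ψ : E3 → ℝ, ContDiff ℝ 2 ψ → HasCompactSupport ψ →
            (∀ i j, Integrable fun x : E3 ↦ T i j x * pd j (pd i ψ) x) ∧
              ∑ i, ∑ j, ∫ x : E3, T i j x * pd j (pd i ψ) x = ∫ x : E3, f x * ψ x)
    (f : E3 → ℝ) (hf : Continuous f) (hfc : HasCompactSupport f) (hfU : tsupport f ⊆ U₁ ∪ U₂)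
    (hmom : ∀ μ, ∫ y : E3, f y * momentFn μ y = 0) :
    ∃ T : Fin 3 → Fin 3 → E3 → ℝ, (∀ i j, support (T i j) ⊆ U₁ ∪ U₂) ∧
      ∀ ψ : E3 → ℝ, ContDiff ℝ 2 ψ → HasCompactSupport ψ →
        (∀ i j, Integrable fun x : E3 ↦ T i j x * pd j (pd i ψ) x) ∧
          ∑ i, ∑ j, ∫ x : E3, T i j x * pd j (pd i ψ) x = ∫ x : E3, f x * ψ x := by
  -- a bump at `p` supported in `U₁ ∩ U₂`
  obtain ⟨ε, hε, hball⟩ := Metric.isOpen_iff.1 (hU₁.inter hU₂) p ⟨hp₁, hp₂⟩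
  let b : ContDiffBump p := ⟨ε / 4, ε / 2, by positivity, by linarith⟩
  set η : E3 → ℝ := fun x ↦ b x with hηdef
  have hη : Continuous η := b.continuous
  have hηc : HasCompactSupport η := b.hasCompactSupport
  have hηp : η p ≠ 0 := by
    have : η p = 1 := b.one_of_mem_closedBall (mem_closedBall_self (by positivity))
    rw [this]; exact one_ne_zero
  have hηU : tsupport η ⊆ U₁ ∩ U₂ := by
    rw [hηdef, b.tsupport_eq]
    exact (closedBall_subset_ball (by show ε / 2 < ε; linarith)).trans hball
  -- a partition of unity on `tsupp f` subordinate to `{U₁, U₂}`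
  let V : Bool → Set E3 := fun c ↦ cond c U₁ U₂
  have hVo : ∀ c, IsOpen (V c) := fun c ↦ by cases c <;> assumption
  have hfV : tsupport f ⊆ ⋃ c, V c := by
    intro x hx
    rcases hfU hx with h | h
    · exact mem_iUnion.2 ⟨true, h⟩
    · exact mem_iUnion.2 ⟨false, h⟩
  obtain ⟨ρ, hρ⟩ := PartitionOfUnity.exists_isSubordinate (isClosed_tsupport f) V hVo hfV
  set χ₁ : E3 → ℝ := fun x ↦ ρ true x with hχ₁def
  set χ₂ : E3 → ℝ := fun x ↦ ρ false x with hχ₂def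
  have hχ₁ : Continuous χ₁ := (ρ true).continuous
  have hχ₂ : Continuous χ₂ := (ρ false).continuous
  have hχ₁U : tsupport χ₁ ⊆ U₁ := hρ true
  have hχ₂U : tsupport χ₂ ⊆ U₂ := hρ false
  have hsum : ∀ x, f x ≠ 0 → χ₁ x + χ₂ x = 1 := by
    intro x hx
    have h := ρ.sum_eq_one (subset_tsupport f (mem_support.2 hx))
    rw [finsum_eq_sum_of_fintype, Fintype.sum_bool] at h
    exact h
  -- split `f = f₁ + f₂` and invert the pieces
  obtain ⟨T₁, hT₁s, hT₁⟩ := h₁ (momentPart η f χ₁) (continuous_momentPart hη hf hχ₁)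
    (hasCompactSupport_momentPart hηc hfc χ₁)
    (tsupport_momentPart_subset_of_tsupport hχ₁U (hηU.trans inter_subset_left) f)
    (fun μ ↦ integral_momentPart_mul_momentFn hη hηc hηp hf hfc hχ₁ μ)
  obtain ⟨T₂, hT₂s, hT₂⟩ := h₂ (momentPart η f χ₂) (continuous_momentPart hη hf hχ₂)
    (hasCompactSupport_momentPart hηc hfc χ₂)
    (tsupport_momentPart_subset_of_tsupport hχ₂U (hηU.trans inter_subset_right) f)
    (fun μ ↦ integral_momentPart_mul_momentFn hη hηc hηp hf hfc hχ₂ μ)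
  refine ⟨fun i j x ↦ T₁ i j x + T₂ i j x, fun i j ↦
    (support_add (T₁ i j) (T₂ i j)).trans (union_subset_union (hT₁s i j) (hT₂s i j)), fun ψ hψ hψc ↦ ?_⟩
  obtain ⟨hI₁, hE₁⟩ := hT₁ ψ hψ hψc
  obtain ⟨hI₂, hE₂⟩ := hT₂ ψ hψ hψc
  have hIij : ∀ i j, Integrable fun x : E3 ↦ (T₁ i j x + T₂ i j x) * pd j (pd i ψ) x := fun i j ↦
    ((hI₁ i j).add (hI₂ i j)).congr (ae_of_all _ fun x ↦ by simp only [Pi.add_apply]; ring)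
  refine ⟨hIij, ?_⟩
  have hsplit : ∀ i j, ∫ x : E3, (T₁ i j x + T₂ i j x) * pd j (pd i ψ) x =
      (∫ x : E3, T₁ i j x * pd j (pd i ψ) x) + ∫ x : E3, T₂ i j x * pd j (pd i ψ) x := by
    intro i j
    rw [← integral_add (hI₁ i j) (hI₂ i j)]
    refine integral_congr_ae (ae_of_all _ fun x ↦ ?_)
    simp only
    ring
  simp only [hsplit, Finset.sum_add_distrib]
  rw [hE₁, hE₂]
  have I : ∀ χ : E3 → ℝ, Continuous χ → Integrable fun x : E3 ↦ momentPart η f χ x * ψ x := fun χ hχ ↦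
    ((continuous_momentPart hη hf hχ).mul hψ.continuous).integrable_of_hasCompactSupport
      (hasCompactSupport_momentPart hηc hfc χ).mul_right
  rw [← integral_add (I χ₁ hχ₁) (I χ₂ hχ₂)]
  refine integral_congr_ae (ae_of_all _ fun x ↦ ?_)
  simp only
  rw [← add_mul, momentPart_add_momentPart_of_moments hf hfc hχ₁ hχ₂ hsum hmom x]

end Union

/-! ### Weak solvability of the double divergence: predicate, base case, recursion -/

section Recursion

/-- **Weak solvability of the double divergence on `U`** (the (S1)–(S2) content of a Bogovskiĭ-type operator, per
density): every continuous compactly supported density `f` with `tsupp f ⊆ U` and `∫ f (1, x₁, x₂, x₃) dx = 0` admits a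
field `T^{ij}` with `supp T^{ij} ⊆ U` such that, for every `ψ ∈ C²_c(ℝ³)`, the pairings `∫ T^{ij} ∂ⱼ∂ᵢψ` converge and
`Σ_{i,j} ∫ T^{ij} ∂ⱼ∂ᵢψ dx = ∫ f ψ dx` (`∂_i∂_j T^{ij} = f` in `𝒟'`). [cite: MaoOhTao2023, Lemma 2.2 (S1)–(S2)] -/
def HasWeakDoubleDivInverse (U : Set E3) : Prop :=
  ∀ f : E3 → ℝ, Continuous f → HasCompactSupport f → tsupport f ⊆ U →
    (∀ μ, ∫ y : E3, f y * momentFn μ y = 0) →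
      ∃ T : Fin 3 → Fin 3 → E3 → ℝ, (∀ i j, support (T i j) ⊆ U) ∧
        ∀ ψ : E3 → ℝ, ContDiff ℝ 2 ψ → HasCompactSupport ψ →
          (∀ i j, Integrable fun x : E3 ↦ T i j x * pd j (pd i ψ) x) ∧
            ∑ i, ∑ j, ∫ x : E3, T i j x * pd j (pd i ψ) x = ∫ x : E3, f x * ψ x

/-- **Gluing**: weak solvability passes to the union of two open sets with a common point.
[cite: MaoOhTao2023, Lemma 2.2 (proof)] -/
theorem HasWeakDoubleDivInverse.union {U₁ U₂ : Set E3} (hU₁ : IsOpen U₁) (hU₂ : IsOpen U₂) {p : E3}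
    (hp₁ : p ∈ U₁) (hp₂ : p ∈ U₂) (h₁ : HasWeakDoubleDivInverse U₁) (h₂ : HasWeakDoubleDivInverse U₂) :
    HasWeakDoubleDivInverse (U₁ ∪ U₂) :=
  fun f hf hfc hfU hmom ↦ exists_weak_inverse_union hU₁ hU₂ hp₁ hp₂ h₁ h₂ f hf hfc hfU hmom

/-- **Base case: star-shaped sets** (Lemma 2.3). If `Ω` is star-shaped with respect to every point of an open ball
`ball c r ⊆ Ω`, then `Ω` has weak solvability of the double divergence: take the Bogovskiĭ-type operator of
Lemma 2.3 with the normalised bump `ζ` of that ball (`BogovskiiOperator.lean`). [cite: MaoOhTao2023, Lemma 2.3] -/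
theorem HasWeakDoubleDivInverse.of_starConvex {Ω : Set E3} {c : E3} {r : ℝ} (hr : 0 < r)
    (hΩ : ∀ b ∈ ball c r, StarConvex ℝ b Ω) : HasWeakDoubleDivInverse Ω := by
  intro f hf hfc hfΩ hmom
  -- the normalised bump `ζ` supported in `ball c r`
  let b : ContDiffBump c := ⟨r / 4, r / 2, by positivity, by linarith⟩
  set ζ : E3 → ℝ := b.normed volume with hζdef
  have hζ : ContDiff ℝ 1 ζ := b.contDiff_normed
  have hζ1 : ∫ z : E3, ζ z = 1 := b.integral_normed
  have hζB : ∀ z, ζ z ≠ 0 → z ∈ ball c r := fun z hz ↦ by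
    have : z ∈ support ζ := mem_support.2 hz
    rw [hζdef, b.support_normed_eq] at this
    exact ball_subset_ball (by show r / 2 ≤ r; linarith) this
  have hR : ∀ z : E3, ‖c‖ + r < ‖z‖ → ζ z = 0 := by
    intro z hz
    by_contra h
    have hzB := hζB z h
    rw [mem_ball, dist_eq_norm] at hzB
    have : ‖z‖ ≤ ‖z - c‖ + ‖c‖ := norm_le_norm_sub_add z c
    linarith
  have hfΩ' : ∀ y, f y ≠ 0 → y ∈ Ω := fun y hy ↦ hfΩ (subset_tsupport f (mem_support.2 hy))
  refine ⟨fun i j x ↦ ∫ y : E3, bogovskiiWeight ζ y ‖x - y‖ (‖x - y‖⁻¹ • (x - y)) *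
      ((x - y) i * ((x - y) j * (‖x - y‖ ^ 3)⁻¹)) * f y, fun i j ↦ ?_, fun ψ hψ hψc ↦ ?_⟩
  · exact support_bogovskiiOperator_subset hΩ hζB hfΩ' i j
  · exact bogovskiiOperator_weak_inverse hζ hR hζ1 f hf hfc hmom ψ hψ hψc

/-- **The recursion of Lemma 2.2**: a finite chain of open sets, each with weak solvability and each meeting the union
of the previous ones, has a union with weak solvability ("by a simple recursion argument, this observation would allow
us to define a Bogovskii-type operator on any finite union of such sets"). [cite: MaoOhTao2023, Lemma 2.2 (proof)] -/
theorem HasWeakDoubleDivInverse.biUnion_le {V : ℕ → Set E3} (hVo : ∀ k, IsOpen (V k))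
    (hV : ∀ k, HasWeakDoubleDivInverse (V k))
    (hchain : ∀ k, ∃ p, p ∈ V (k + 1) ∧ p ∈ ⋃ i ≤ k, V i) (n : ℕ) :
    HasWeakDoubleDivInverse (⋃ i ≤ n, V i) := by
  induction n with
  | zero =>
    have h0 : (⋃ i ≤ 0, V i) = V 0 := by
      ext x
      simp only [mem_iUnion, exists_prop, Nat.le_zero]
      exact ⟨fun ⟨i, hi, hx⟩ ↦ hi ▸ hx, fun hx ↦ ⟨0, rfl, hx⟩⟩
    rw [h0]
    exact hV 0
  | succ n ih =>
    rw [Set.biUnion_le_succ]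
    obtain ⟨p, hp1, hp2⟩ := hchain n
    exact ih.union (isOpen_biUnion fun i _ ↦ hVo i) (hVo (n + 1)) hp2 hp1 (hV (n + 1))

end Recursion

end MaoOhTao

end Literature.Geometry.Lorentzian

end
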